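import Summits.ResolutionOfSingularities.ResolutionOfSingularities.Theorems.FrobeniusLadderFInjectiveMacaulayficationDominatingLocFixLocalDimLe2
import Literature.AlgebraicGeometry.CossartPiltant200819.GoodResolutionOneBlowupQuasiExcellent2019
import Literature.AlgebraicGeometry.Resolution.Temkin2008Localization
import Literature.AlgebraicGeometry.Resolution.BirationalDimensionInequality
import Literature.AlgebraicGeometry.Resolution.BlowupsProperProofs
import HarnessLib

/-!
# I-B: every blowing up of `Spec 𝒪_{X,x}` at a point of local dimension three ADMITS A DESINGULARIZATION (Cossart–Piltant, by name)
# (crux `FInjectiveMacaulayfication` stmt-ResolutionOfSingularities-15315, chain w45a; res-L1-w45a-plan-1 RULING R16.61/R16.63 — the hypothesis `hloc`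
# of res-L1-w45a-lead-1's THEOREM A induction `DesingularizationOffClosedPoints.desingularization_offClosedPoints_of_local` (Temkin 2008 Prop. 2.3.4
# truncated at codimension three); seat res-L1-w45a-stub-1 g7)

[OURS · L1 W4.5a] Support file (`--supports stmt-ResolutionOfSingularities-15315 --as helper`); NOT a statement of any manuscript; def-free; a THEOREM
modulo three printed results BY NAME (`CossartPiltant2019General` = CP 2019 Thm. 1.1 (i)(ii); `Stacks081R` = Raynaud–Gruson 1971 Thm. 5.2.2;
`CossartPiltant2019Principalization` = CP 2019 Prop. 4.4); AI-written (AI review is weaker than expert review).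

`admitsDesingularization_of_isBlowup_stalk_dimThree (hG h081R hP)`: `X` integral and locally of finite type over a field `K`, `x ∈ X` with
`dim 𝒪_{X,x} = 3`, `g : S′ → Spec 𝒪_{X,x}` ANY blowing up (along any ideal sheaf `I`). Then `S′` admits a desingularization in the sense of Temkin
Def. 2.2.6 (`Scheme.AdmitsDesingularization`: a blowing up `S″ → S′` with centre in `Sing S′` and `S″` regular). Proof: if `I = ⊥` the blowing up is
EMPTY (the unit ideal sheaf is not an effective Cartier divisor at any point), and the identity is a desingularization; if `I ≠ ⊥` then `S′` is
integral (`IsBlowup.isIntegral`), Noetherian and separated (proper over the Noetherian affine `Spec 𝒪_{X,x}`), quasi-excellent (Stacks 07QW/07QU: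
`isQuasiExcellentRing_stalk`, `IsQuasiExcellent.of_locallyOfFiniteType`) and of dimension `3` (`IsBirational.topologicalKrullDim_eq_of_isProper`), so the
tree's Cossart–Piltant export `CP2019.exists_isBlowup_isRegular_of_dim_three_of_isQuasiExcellent` gives a blowing up `ρ : T → S′` with `T` regular
and centre supported in `(Reg S′)ᶜ` — a desingularization. (+ `localBlowups_hloc` = lead-1's `hloc` binder verbatim. The 4-fold instantiation
`desingularization_offFinite_of_local hk f₀ (localBlowups_hloc hG h081R hP f₀) (TerminationModClosedPoints.exists_mem_ringKrullDim_eq_three f₀ h4)` typechecks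
and EQUALS res-L1-w45a-stub-3's already-landed `TerminationModClosedPoints.exists_isBlowup_regular_offFinite` (dedup), so it is not restated here.)
[cite: CossartPiltant2019, Thm. 1.1 (i)(ii); Prop. 4.4] [cite: RaynaudGruson1971, Thm. 5.2.2] [cite: Temkin2008, Def. 2.2.6; Prop. 2.3.4 (iii)]
[cite: StacksProject, Tag 07QW; Tag 07QU; Tag 01RN]
-/

-- single-problem summit: the doubled namespace component is forced
set_option linter.dupNamespace false

noncomputable section

namespace Summit.ResolutionOfSingularities.ResolutionOfSingularities.Theorems.FInjectiveMacaulayfication.LocalBlowupDesingularizationDimThree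

open CategoryTheory CategoryTheory.Limits AlgebraicGeometry TopologicalSpace IsLocalRing
open Literature.AlgebraicGeometry.Resolution Literature.AlgebraicGeometry.CossartPiltant200819
open Scheme.IdealSheafData

/-- The blowing up along the ZERO ideal sheaf is the empty scheme: `⊥𝒪_{S′} = ⊥` would have to be an effective Cartier divisor. [folklore] -/
theorem isEmpty_of_isBlowup_bot {S' S : Scheme.{0}} {g : S' ⟶ S} (hg : IsBlowup g (⊥ : S.IdealSheafData)) : IsEmpty S' := by
  by_contra h
  rw [not_isEmpty_iff] at h
  obtain ⟨y⟩ := h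
  have h1 := hg.isEffectiveCartier
  rw [Scheme.IdealSheafData.comap_bot] at h1
  exact DominatingLocFixLocalDimLe2.not_isEffectiveCartier_bot y h1

/-- An empty scheme admits a desingularization (the identity, a blowing up along `⊤`). [folklore] -/
theorem admitsDesingularization_of_isEmpty (S' : Scheme.{0}) [IsEmpty S'] : Scheme.AdmitsDesingularization S' :=
  ⟨S', 𝟙 S', ⟨⟨⊤, isBlowup_id_top S', by simp⟩, fun x => (IsEmpty.false x).elim⟩⟩

/-- **I-B. Every blowing up of `Spec 𝒪_{X,x}`, `dim 𝒪_{X,x} = 3`, admits a desingularization** (`X` integral, locally of finite type over a field),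
modulo CP 2019 Thm. 1.1 + Raynaud–Gruson + CP 2019 Prop. 4.4 BY NAME. [OURS · conditional-result]
[cite: CossartPiltant2019, Thm. 1.1 (i)(ii); Prop. 4.4] [cite: Temkin2008, Def. 2.2.6; Prop. 2.3.4 (iii)] [cite: StacksProject, Tag 07QU] -/
theorem admitsDesingularization_of_isBlowup_stalk_dimThree
    (hG : CossartPiltant2019General.{0}) (h081R : Stacks081R.{0}) (hP : CossartPiltant2019Principalization.{0})
    {K : Type} [Field K] {X : Scheme.{0}} (f₀ : X ⟶ Spec (.of K)) [LocallyOfFiniteType f₀] [IsIntegral X]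
    (x : X) (hdim : ringKrullDim (X.presheaf.stalk x) = 3)
    (S' : Scheme.{0}) (g : S' ⟶ Spec (X.presheaf.stalk x)) (I : (Spec (X.presheaf.stalk x)).IdealSheafData) (hg : IsBlowup g I) :
    Scheme.AdmitsDesingularization S' := by
  classical
  haveI : IsLocallyNoetherian X := LocallyOfFiniteType.isLocallyNoetherian f₀
  by_cases hI : I = ⊥
  · subst hI
    haveI := isEmpty_of_isBlowup_bot hg
    exact admitsDesingularization_of_isEmpty S'
  -- `S := Spec 𝒪_{X,x}`: integral, Noetherian, affine, quasi-excellent, of dimension `3`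
  have hqX : Scheme.IsQuasiExcellent X := Scheme.isQuasiExcellent_of_locallyOfFiniteType Stacks07QW_field_holds f₀
  have hqR : IsQuasiExcellentRing (X.presheaf.stalk x) := hqX.isQuasiExcellentRing_stalk x
  have hqe : Scheme.IsQuasiExcellent (Spec (X.presheaf.stalk x)) :=
    Scheme.isQuasiExcellent_of_locallyOfFiniteType_of_isQuasiExcellentRing Stacks07QU_holds hqR (𝟙 _)
  have hdimS : topologicalKrullDim (Spec (X.presheaf.stalk x)) = 3 := by
    change topologicalKrullDim (PrimeSpectrum (X.presheaf.stalk x)) = 3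
    rw [PrimeSpectrum.topologicalKrullDim_eq_ringKrullDim, hdim]
  -- `S′`: integral, proper over `S` hence Noetherian and separated, quasi-excellent, of dimension `3`
  haveI : IsIntegral S' := hg.isIntegral hI
  haveI : IsProper g := hg.isProper
  haveI : IsLocallyNoetherian S' := LocallyOfFiniteType.isLocallyNoetherian g
  haveI : CompactSpace S' := QuasiCompact.compactSpace_of_compactSpace g
  haveI : IsNoetherian S' := {}
  haveI : S'.IsSeparated := Scheme.isSeparated_of_isSeparated_over g
  have hqe' : Scheme.IsQuasiExcellent S' := Scheme.IsQuasiExcellent.of_locallyOfFiniteType g hqe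
  have hdim' : topologicalKrullDim S' = 3 := by
    rw [(hg.isBirational' hI).topologicalKrullDim_eq_of_isProper]
    exact hdimS
  -- Cossart–Piltant: one blowing up `ρ : T → S′` along `𝓛` with `T` regular and `supp 𝓛 ⊆ (Reg S′)ᶜ`
  obtain ⟨𝓛, T, ρ, -, hρ, hTreg, U, hU, h𝓛U, -⟩ := CP2019.exists_isBlowup_isRegular_of_dim_three_of_isQuasiExcellent hG h081R hP hqe' hdim'
  refine ⟨T, ρ, ⟨⟨𝓛, hρ, ?_⟩, hTreg⟩⟩
  rw [← hU]
  exact h𝓛U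

/-- **I-B in the shape of `hloc`** of `DesingularizationOffClosedPoints.desingularization_offClosedPoints_of_local` (verbatim binder).
[OURS · conditional-result] [cite: CossartPiltant2019, Thm. 1.1 (i)(ii); Prop. 4.4] [cite: Temkin2008, Prop. 2.3.4 (iii)] -/
theorem localBlowups_hloc
    (hG : CossartPiltant2019General.{0}) (h081R : Stacks081R.{0}) (hP : CossartPiltant2019Principalization.{0})
    {K : Type} [Field K] {X : Scheme.{0}} (f₀ : X ⟶ Spec (.of K)) [LocallyOfFiniteType f₀] [IsIntegral X] :
    ∀ x : X, ringKrullDim (X.presheaf.stalk x) = 3 →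
      ∀ (S' : Scheme.{0}) (g : S' ⟶ Spec (X.presheaf.stalk x)) (I : (Spec (X.presheaf.stalk x)).IdealSheafData),
        IsBlowup g I → Scheme.AdmitsDesingularization S' :=
  fun x hdim S' g I hg => admitsDesingularization_of_isBlowup_stalk_dimThree hG h081R hP f₀ x hdim S' g I hg

end Summit.ResolutionOfSingularities.ResolutionOfSingularities.Theorems.FInjectiveMacaulayfication.LocalBlowupDesingularizationDimThree

end
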